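import Literature.NumberTheory.EllipticCurves.BSDRootNumberSmallConductorProofs
import Literature.NumberTheory.EllipticCurves.Rank1Residual.Predicates
import HarnessLib

/-!
# Kezuka–Li 2020, Cor. 1.2: the `3`-part of BSD for the rank-one cube-sum curves `x³ + y³ = 2p` (`p ≡ 2 mod 9`) and `x³ + y³ = 2p²` (`p ≡ 5 mod 9`)

HONEST FRAMING (cell `b2b-bsdres`, run/shared/lean/b2b/bsd-rank1-residual/; harvest seat
`b2b-bsdres-harvest-1`, gen 2): prove what is provable now; shrink each hard class to its core with
data; no claim beyond stated classes. The cell deletes the COMBINATION-SHAPED residual classes of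
the BSD formula in analytic rank `≤ 1` from PUBLISHED theorems only and TYPES the
construction-shaped ones; this is not "finishing BSD". This file vendors ONE published theorem
(named fact, nothing asserted; D-0014) bearing on the RAMIFIED corner of the construction-shaped
class X12 (RESIDUAL-CASES §a.2: "CM, rank 1, `p ∣ 6·d_K·N`, `p` not split"; after harvest-1 gen 1
its open remainder is `p = 2`, `p` ramified in `K`, `p` inert in `K` with `p ∣ N`). At `p = 3` with
`K = ℚ(√-3)` (`j = 0`, the curves `y² = x³ + D`) the census (v5, collector 2026-08-18T19:14:57Z)
holds 98 classes, all of analytic rank `1`; 26 of them are cube-sum curves `C_n : x³ + y³ = n`.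
Nothing CLASS-level is in print for this corner; what is in print are FAMILY theorems for cube
sums, of which this is the self-contained one (the others — Hu–Shu–Yin, Trans. AMS 372 (2019)
Thm. 1.4; Shu–Yin, Math. Ann. 385 (2022) Thm. 1.2 — are PRODUCT formulas for a rank-one and a
rank-zero curve and need Burungale–Flach 2024 for the rank-zero factor; see the harvest's
HARVEST.md rows C13/C14). Census reach of this file: the classes **2700h** (`n = 50 = 2·5²`,
`5 ≡ 5 mod 9`) and **13068c** (`n = 22 = 2·11`, `11 ≡ 2 mod 9`) — 2 of the 98 (1 with `N < 10⁴`).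
The label of X12 does not change (construction-shaped; family theorems are per-curve tools).

Source (read this session, EMS open access `paper:doi-10-4171-dm-795`). Y. Kezuka, Y. Li, *A
classical family of elliptic curves having rank one and the `2`-primary part of their
Tate–Shafarevich group non-trivial*, Doc. Math. 25 (2020) 2115–2147, doi:10.4171/dm/795
[KezukaLi2020]. Notation (p. 2115): "Let `n ≥ 3` be a cube free integer. The elliptic curve
`C_n : x³ + y³ = n` …"; (1.1): "`p ≡ 2 mod 9` or `p ≡ 5 mod 9`"; p. 2116: "We write `Ш(C_n)` for the
Tate–Shafarevich group of `C_n` over `ℚ`."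

* **Theorem 1.1** (p. 2116, rank-zero members, verbatim core): "Let `p` be an odd prime satisfying
  (1.1). 1. If `p ≡ 5 mod 9`, the `L`-values `L(C_{2p}, 1)` and `L(C_{2²p²}, 1)` are both non-zero,
  and the `3`-part of the Birch–Swinnerton-Dyer conjecture holds for `C_{2p}` and `C_{2²p²}`. …
  2. If `p ≡ 2 mod 9`, the `L`-values `L(C_{2p²}, 1)` and `L(C_{2²p}, 1)` are both non-zero, and the
  `3`-part of the Birch–Swinnerton-Dyer conjecture holds for `C_{2p²}` and `C_{2²p}`. …" (these
  rank-zero CM curves are inside census class X0, closed by Burungale–Flach 2024; not transcribed).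
* **Corollary 1.2** (pp. 2116–2117, VERBATIM): "Let `p` be an odd prime satisfying (1.1).
  1. If `p ≡ 2 mod 9`, the curve `C_{2p}` has rank `1` and `L(C_{2p}, s)` has a simple zero at
  `s = 1`. Furthermore, `Ш(C_{2p})` is finite and the `3`-part of the Birch–Swinnerton-Dyer
  conjecture holds for `C_{2p}`.
  2. If `p ≡ 5 mod 9`, the curve `C_{2p²}` has rank `1` and `L(C_{2p²}, s)` has a simple zero at
  `s = 1`. Furthermore, `Ш(C_{2p²})` is finite and the `3`-part of the Birch–Swinnerton-Dyer
  conjecture holds for `C_{2p²}`."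
* The model, (4.1) (p. 2139): "Since a global minimal Weierstrass model of `C_2` is given by
  `y² = x³ − 27`, we know that `y² = x³ − 27p^{2j}` (`j = 1, 2`) gives a minimal model of `C_{2p^j}`
  at `2`."
* Proof (pp. 2138–2139, "Proof of Theorem 1.1 and Corollary 1.2"): rank one and the simple zero by
  "a theorem of Satgé [20] and the theorem of Gross–Zagier and Kolyvagin" (P. Satgé, Invent. Math.
  87 (1987) 425–439); the `3`-part of BSD for the PRODUCT `C_{2p} × C_{2p²}` from "[2]" (L. Cai,
  J. Shu, Y. Tian, Amer. J. Math. 139 (2017) 785–816 [CaiShuTian2017]), display (3.16); the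
  `3`-part for the rank-zero factor by the paper's Thm. 3.6 (non-vanishing and the explicit
  modulo-`3` BSD congruence) and Prop. 3.11 (a `3`-descent: `Ш[3] = 0`), display (3.17); "Now the
  `3`-part of the Birch–Swinnerton-Dyer conjecture for `C_{2p²}` follows from (3.16) and (3.17)".
  The BSD formula meant is the full leading-term formula `L^{(r)}(C_n,1)/(r!·Ω·Reg) =
  #Ш ∏ c_ℓ / #C_n(ℚ)_tor²` (display (3.16): `L(C_{2p},1) L'(C_{2p²},1)/(Ω_{2p} Ω_{2p²} ĥ(P)) =
  T(C_{2p}) T(C_{2p²}) #Ш(C_{2p}) #Ш(C_{2p²})` up to `3`-adic units, `T` = product of Tamagawa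
  numbers, `C_n(ℚ)_tor = 0`), read `3`-adically. Status: PUB (refereed, 2020); all inputs published.

Transcription (tree dictionary of `BSDRootNumberSmallConductorProofs`: Miller's `#Ш_an = shaAn W`,
`BSD(E,p) = BSDp W p`): the curve is given by ANY globally minimal model `W/ℚ` which is
`ℚ`-isomorphic (a `VariableChange`) to Kezuka–Li's model (4.1) `y² = x³ − 27 p^{2j}`
(`cubeSumTwoModel p j`; `j = 1` for `p ≡ 2 mod 9`, `j = 2` for `p ≡ 5 mod 9`); "odd prime" =
`p.Prime ∧ p ≠ 2`; "rank 1 and a simple zero" = `W.mordellWeilRank = 1 ∧ W.analyticRank = 1`;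
"`Ш` finite" = `Finite W.sha`; "the `3`-part of BSD holds" = `#Ш_an` is a rational `q` with
`ord₃ q = ord₃ #Ш(3)` (Miller's period `Ω = ∫_{E(ℝ)}|ω|` differs from the paper's `Ω_n` (1.2) at
most by a power of `2` and by the unit attached to the choice of minimal model — invisible at `3`).
Nothing weaker or stronger is transcribed; `p = 2`, the `2`-part and every prime other than `3`
are outside the statement (for `ℓ ∤ 6` odd good or split primes see `Kobayashi2013`,
`LiLiuTian2024`). No `_holds` expected (Heegner points on `X_0(3^5)`/cubic twists, explicit
Gross–Zagier, `3`-descent over `ℚ(∛p)` are not in Mathlib); consumers take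
`(h : cor12_threePart_of_cubeSum)`.

Census identification (Cremona `allcurves`, checked this session): `cubeSumTwoModel 11 1 =
[0,0,0,0,-3267] = 13068c2` and `cubeSumTwoModel 5 2 = [0,0,0,0,-16875] = 2700h2`
(`cubeSumTwoModel_eleven_one`, `cubeSumTwoModel_five_two` below); the census records are the
`3`-isogenous curves `13068c1 = [0,0,0,0,121]`, `2700h1 = [0,0,0,0,625]`, reached from `c2`/`h2`
by `Wuthrich2014.bsdp_of_isIsogenous` (Cassels' invariance of the BSD quotient) — a lane step,
not done here; global minimality of the two models is likewise the lane's certificate.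

## References
* [KezukaLi2020] Y. Kezuka, Y. Li, Doc. Math. 25 (2020) 2115–2147, Thm. 1.1, Cor. 1.2 (pp. 2116–2117), (4.1) (p. 2139), proof pp. 2138–2139.
* [CaiShuTian2017] L. Cai, J. Shu, Y. Tian, Amer. J. Math. 139 (2017) 785–816 (the product formula, KL's [2]).
* P. Satgé, *Un analogue du calcul de Heegner*, Invent. Math. 87 (1987) 425–439 (KL's [20]).
* [Miller2011LMS] R. L. Miller, LMS J. Comput. Math. 14 (2011), Def. 1.1; RESIDUAL-CASES.md §a.2 X12; HOME/b2b-bsdres-harvest-1/HARVEST.md row C12, RECLASSIFY.md (gen-2 addendum).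
-/

noncomputable section

open scoped Classical

open WeierstrassCurve Literature.NumberTheory.EllipticCurves
  Literature.NumberTheory.EllipticCurves.Rank1Residual

namespace Literature.NumberTheory.EllipticCurves.KezukaLi2020

/-- Kezuka–Li's Weierstrass model (4.1) of the cube-sum curve `C_{2p^j} : x³ + y³ = 2p^j`:
`y² = x³ − 27 p^{2j}` ("gives a minimal model of `C_{2p^j}` at `2`").
[cite: KezukaLi2020, (4.1) (p. 2139)] -/
def cubeSumTwoModel (p j : ℕ) : WeierstrassCurve ℚ :=
  ⟨0, 0, 0, 0, -27 * (p : ℚ) ^ (2 * j)⟩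

/-- Census identification: `C_{22}` (`p = 11 ≡ 2 mod 9`, `j = 1`) is `y² = x³ − 3267`, Cremona
`13068c2`. [cite: KezukaLi2020, (4.1) (p. 2139)] -/
theorem cubeSumTwoModel_eleven_one : cubeSumTwoModel 11 1 = ⟨0, 0, 0, 0, -3267⟩ := by
  simp only [cubeSumTwoModel]
  norm_num

/-- Census identification: `C_{50}` (`p = 5 ≡ 5 mod 9`, `j = 2`) is `y² = x³ − 16875`, Cremona
`2700h2`. [cite: KezukaLi2020, (4.1) (p. 2139)] -/
theorem cubeSumTwoModel_five_two : cubeSumTwoModel 5 2 = ⟨0, 0, 0, 0, -16875⟩ := by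
  simp only [cubeSumTwoModel]
  norm_num

/-- **Kezuka–Li, Doc. Math. 25 (2020), Cor. 1.2** (verbatim in the module docstring): "Let `p` be
an odd prime satisfying (1.1) [`p ≡ 2` or `5 mod 9`]. 1. If `p ≡ 2 mod 9`, the curve `C_{2p}` has
rank `1` and `L(C_{2p}, s)` has a simple zero at `s = 1`. Furthermore, `Ш(C_{2p})` is finite and the
`3`-part of the Birch–Swinnerton-Dyer [formula] holds for `C_{2p}`. 2. If `p ≡ 5 mod 9`, the curve
`C_{2p²}` has rank `1` and `L(C_{2p²}, s)` has a simple zero at `s = 1`. Furthermore, `Ш(C_{2p²})`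
is finite and the `3`-part of the Birch–Swinnerton-Dyer [formula] holds for `C_{2p²}`." Inputs as
printed: Satgé 1987 (Heegner-point rank one), Gross–Zagier, Kolyvagin, Cai–Shu–Tian 2017 (the
`3`-part for the product `C_{2p} × C_{2p²}`, display (3.16)), the paper's Thm. 3.6 and Prop. 3.11
(the rank-zero factor, display (3.17)). Transcription (module docstring): `W` any globally
minimal model `ℚ`-isomorphic to the model (4.1) `y² = x³ − 27p^{2j}` (`j = 1` resp. `2`) ⇒
`rank = 1`, `r_an = 1`, `Ш` finite, and Miller's `#Ш_an` is a rational `q` with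
`ord₃ q = ord₃ #Ш(3)`. FAMILY-shaped (density zero inside X12's ramified corner); census reach:
classes 2700h, 13068c. STATUS PUB.
[cite: KezukaLi2020, Cor. 1.2 (pp. 2116–2117), (4.1) (p. 2139), proof (pp. 2138–2139)] [cite: CaiShuTian2017] [cite: Miller2011LMS, Def. 1.1] -/
def cor12_threePart_of_cubeSum : Prop :=
  ∀ (p : ℕ), p.Prime → p ≠ 2 → ∀ (j : ℕ), (p % 9 = 2 ∧ j = 1) ∨ (p % 9 = 5 ∧ j = 2) →
    ∀ (W : WeierstrassCurve ℚ) [W.IsElliptic] [W.IsGloballyMinimal],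
      (∃ C : VariableChange ℚ, C • W = cubeSumTwoModel p j) →
      W.mordellWeilRank = 1 ∧ W.analyticRank = 1 ∧ Finite W.sha ∧
        ∃ q : ℚ, shaAn W = (q : ℂ) ∧
          padicValRat 3 q = padicValNat 3 (Nat.card (AddCommGroup.primaryComponent W.sha 3))

/-- **Cor. 1.2 ⇒ Miller's `BSD(E,3)`** (`BSDp W 3`) together with `r_an = 1`, for any globally
minimal model of `C_{2p}` (`p ≡ 2 mod 9`) or `C_{2p²}` (`p ≡ 5 mod 9`) — pure bookkeeping
(`Ш` finite ⇒ `Ш(3)` finite; `rank = 1 = r_an`). These pairs `(E, 3)` lie in census class X12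
(`j = 0`: CM by `ℚ(√-3)`, in which `3` ramifies; `3 ∣ N`); the theorem closes them per curve.
[cite: KezukaLi2020, Cor. 1.2 (pp. 2116–2117)] [cite: Miller2011LMS, Def. 1.1] -/
theorem bsdp_three_of_cor12 (h : cor12_threePart_of_cubeSum) {p j : ℕ} (hp : p.Prime)
    (hp2 : p ≠ 2) (hpj : (p % 9 = 2 ∧ j = 1) ∨ (p % 9 = 5 ∧ j = 2))
    (W : WeierstrassCurve ℚ) [W.IsElliptic] [W.IsGloballyMinimal]
    (hW : ∃ C : VariableChange ℚ, C • W = cubeSumTwoModel p j) :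
    W.analyticRank = 1 ∧ BSDp W 3 := by
  obtain ⟨hrank, hr, hfin, q, hq, hv⟩ := h p hp hp2 j hpj W hW
  haveI : Finite W.sha := hfin
  exact ⟨hr, by rw [hrank, hr], Finite.of_injective _ Subtype.val_injective, q, hq, hv⟩

/-- The `p ≡ 2 mod 9` case spelled out: a globally minimal model of `x³ + y³ = 2p` satisfies
`BSD(E,3)` (e.g. `p = 11`: class 13068c). [cite: KezukaLi2020, Cor. 1.2 (1)] -/
theorem bsdp_three_of_cubeSum_two_mul (h : cor12_threePart_of_cubeSum) {p : ℕ} (hp : p.Prime)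
    (h9 : p % 9 = 2) (hp2 : p ≠ 2) (W : WeierstrassCurve ℚ) [W.IsElliptic] [W.IsGloballyMinimal]
    (hW : ∃ C : VariableChange ℚ, C • W = cubeSumTwoModel p 1) : BSDp W 3 :=
  (bsdp_three_of_cor12 h hp hp2 (Or.inl ⟨h9, rfl⟩) W hW).2

/-- The `p ≡ 5 mod 9` case spelled out: a globally minimal model of `x³ + y³ = 2p²` satisfies
`BSD(E,3)` (e.g. `p = 5`: class 2700h). [cite: KezukaLi2020, Cor. 1.2 (2)] -/
theorem bsdp_three_of_cubeSum_two_mul_sq (h : cor12_threePart_of_cubeSum) {p : ℕ} (hp : p.Prime)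
    (h9 : p % 9 = 5) (W : WeierstrassCurve ℚ) [W.IsElliptic] [W.IsGloballyMinimal]
    (hW : ∃ C : VariableChange ℚ, C • W = cubeSumTwoModel p 2) : BSDp W 3 :=
  (bsdp_three_of_cor12 h hp (by rintro rfl; norm_num at h9) (Or.inr ⟨h9, rfl⟩) W hW).2

end Literature.NumberTheory.EllipticCurves.KezukaLi2020
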